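import Literature.NumberTheory.LFunctions.RamareLOneEvenSmoothing
import Literature.NumberTheory.QuadraticFields.KroneckerCharacterEvenDiscriminant
import Literature.NumberTheory.QuadraticFields.JacobiCharacterPrimitiveProofs
import Literature.NumberTheory.QuadraticFields.RealQuadraticRegulator
import HarnessLib

/-!
# Le's bound `h(ℚ(√d)) ≤ √d/2` for real quadratic fields (Ramaré 2001, Corollary 2) — proved

Topic `Literature/NumberTheory/LFunctions`, namespace `Literature.NumberTheory.LFunctions.Ramare2001`.
Everything in this file is PROVED (theorems only; no definition, no named fact; standard axioms).
It discharges the named fact `Literature.NumberTheory.LFunctions.ramare2001_corollary2`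
(`ExplicitLOneUpperBounds.lean`; the `_holds` theorem is appended there):

> **Corollary 2 (Le).** For every real quadratic field of discriminant `q ≥ 16`, `h(ℚ(√q)) ≤ ½√q`.

(O. Ramaré, Acta Arith. 100 (2001) p. 248; M. Le, Acta Arith. 68 (1994) 141–144, Theorem (a):
`h ≤ [√Δ/2]` for every square-free `D`, `Δ` the discriminant.)

## The printed proof (Ramaré 2001, §IX p. 265) and how it is followed

«We prove Corollary 2. By the Dirichlet class number formula, we have
`h(ℚ(√q)) = √q · L(1, χ_q)/(2 log ε_q)` where `χ_q` is the even primitive real character modulo `q`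
and `ε_q` is the fundamental unit. We assume `q ≥ 5`. Classically (see [Le, Lemma 4] for instance),
we have **Lemma 19.** `ε_q ≥ (√(q − 4) + √q)/2`. Recalling (6.4), we thus reach
`(2/√q) h(ℚ(√q)) ≤ (½ log q − log(5q/7)/(2√q))/log((√(q−4)+√q)/2)`, which is not more than `1` if
`q ≥ 6`. We end the proof by direct examination.»  Here (6.4) (p. 262) is the even-character bound
with a NEGATIVE secondary term, `|L(1, χ)| ≤ ½ log q − (log 2π − 2 + ½ log q)/√q ≤ ½ log q − log(5q/7)/(2√q)`.

The Lean road is the same three-step architecture: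

1. **(6.4), honest constant** (`norm_LFunction_one_le_half_log_sub_div_sqrt`): for every even primitive
   `χ ≠ 1` mod `q`, `‖L(1,χ)‖ ≤ ½ log q − (½ log q − 6 + log π)/√q`.  This is Ramaré's Proposition 2 at
   `δ = q^{-1/2}` with Lemma 16 and the tree's dual-sum bound `Σ_m J(m/√q) ≤ √q − log √q + (5 − log π)`
   (`VaalerDualKernel.sum_vaalerJ_le`; the printed dual constant `−(log 2π − 1)` rests on the §VI line
   flagged in `VaalerDualKernel.lean` — FINDING F1 of the typing seat — so the secondary term here is
   `½ log q − 6 + log π` instead of the printed `½ log q + log 2π − 2`; it is negative-signed, i.e. an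
   improvement on `½ log q`, as soon as `log q > 12 − 2 log π = 9.71…`).
2. **A uniform improvement on `½ log q`** (`norm_LFunction_one_le_half_log_sub_div`,
   `norm_LFunction_one_le_half_log_sub_four`): for even primitive `χ ≠ 1` mod `q ≥ 16`,
   `‖L(1,χ)‖ ≤ ½ log q − 8/(3q) ≤ ½ log(q − 4)`; for `q > 25000` from step 1, for `16 ≤ q ≤ 25000` from
   Louboutin's `‖L(1,χ)‖ ≤ ½ log q + µ − (½ log q − µ)/√q`, `0.023 < µ < 0.0231`
   (`Louboutin2001.norm_LFunction_one_le_sub`, `DirichletLOneHalfLogBoundEven.lean`) — this replaces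
   Ramaré's «direct examination» of the small discriminants by a second printed theorem, exactly as the
   tree's proof of Corollary 1 (even) does (`RamareLOneEvenSmoothing.lean`).
3. **Lemma 19** (`sqrt_sub_four_add_sqrt_div_two_le_fundUnit`, `half_log_discr_sub_four_le_regulator`):
   `ε_d ≥ (√(d−4) + √d)/2 ≥ √(d − 4)`, so `R_K = log ε_{d_K} ≥ ½ log(d_K − 4)` (tree:
   `Quadratic.regulator_eq_log_fundUnit'`, `QuadIrr.exists_fundUnit_eq` — `ε_d = (G + B√d)/2`,
   `G² − dB² = ±4`, `G, B ≥ 1`).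
4. **Assembly** (`classNumber_le_half_sqrt`): with the even primitive Kronecker character `κ` mod `d_K`
   (`ζ_K = ζ · L(s, κ)`, `L(1, κ) = Res_{s=1} ζ_K = 2 h_K R_K/√d_K`, Mathlib's class number formula
   `NumberField.dedekindZeta_residue` with `r₁ = 2`, `r₂ = 0`, `w_K = 2`):
   `2 h_K R_K/√d_K = L(1, κ) ≤ ½ log(d_K − 4) ≤ R_K`, hence `h_K ≤ √d_K/2` for `d_K ≥ 16`.

Deviation from print, stated once more: the meeting point `½ log(q − 4)` (instead of Ramaré's displayed
quotient) and the small-`q` range by Louboutin's theorem instead of a finite check; constants otherwise as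
printed (`√q/2`, threshold `16`).  No numerics beyond decimal bounds on `log 2`, `log π`, `e`.

## References

* O. Ramaré, *Approximate formulae for `L(1, χ)`*, Acta Arith. 100 (2001) 245–266: Corollary 2 p. 248,
  (6.4) p. 262, §IX and Lemma 19 p. 265. [cite: Ramare2001LOneApproximateFormulae, Cor. 2 p. 248 / §IX p. 265]
* M. Le, *Upper bounds for class numbers of real quadratic fields*, Acta Arith. 68 (1994) 141–144:
  Theorem (a) p. 141, Lemma 4 (1) p. 142. [cite: Le1994, Theorem (a) p. 141]
* S. Louboutin, Canad. J. Math. 53 (2001) 1194–1222, Thm 7 (15). [cite: Louboutin2001CJM, Thm 7 (15) p. 1197]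
-/

noncomputable section

open Real Filter Topology Set MeasureTheory intervalIntegral Finset
open Literature.Analysis.Fourier

namespace Literature.NumberTheory.LFunctions.Ramare2001

variable {q : ℕ} [NeZero q] (χ : DirichletCharacter ℂ q)

/-! ## Step 1: (6.4) — the even bound with its secondary term -/

section SecondaryTerm

/-- `exp n ≤ c` from a decimal bound `2.7182818286ⁿ ≤ c`. [folklore] -/
private theorem exp_nat_le' {n : ℕ} {c : ℝ} (h : (2.7182818286 : ℝ) ^ n ≤ c) : Real.exp n ≤ c := by
  calc Real.exp n = Real.exp 1 ^ n := by rw [← Real.exp_nat_mul, mul_one]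
    _ ≤ (2.7182818286 : ℝ) ^ n :=
        pow_le_pow_left₀ (Real.exp_pos _).le Real.exp_one_lt_d9.le n
    _ ≤ c := h

/-- **Ramaré 2001, (6.4) with the tree's dual constant**: for every even primitive Dirichlet character
`χ ≠ 1` mod `q`, `‖L(1,χ)‖ ≤ ½ log q − (½ log q − 6 + log π)/√q` — Proposition 2 at `δ = q^{-1/2}`,
Lemma 16 (`Σ(1 − H(δn))/n = −log δ − 1 + δ`), `|τ(χ)| = √q`, and the dual-sum bound
`Σ_m J(m/√q) ≤ √q − log √q + (5 − log π)`.  (Printed: `−(log 2π − 2 + ½ log q)/√q`.)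
[cite: Ramare2001LOneApproximateFormulae, (6.4) p. 262] -/
theorem norm_LFunction_one_le_half_log_sub_div_sqrt (hχ : χ.IsPrimitive) (hχ1 : χ ≠ 1)
    (heven : χ.Even) :
    ‖χ.LFunction 1‖ ≤ Real.log q / 2 - (Real.log q / 2 - 6 + Real.log π) / Real.sqrt q := by
  have hqne : q ≠ 0 := NeZero.ne q
  have hq1' : q ≠ 1 := by rintro rfl; exact hχ1 χ.level_one
  have hq0 : (0:ℝ) < q := by positivity
  have hq1 : (1:ℝ) < q := by exact_mod_cast (show 1 < q by omega)
  set Φ : ℝ → ℝ := fun u => Real.cos (π * u) / (Real.sinc (π * u) + Real.sinc (π * (1 - u))) + u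
    with hΦ
  set J : ℝ → ℝ := fun y => 2 * ∫ u in y..1, Φ (min u 1) / u with hJ
  set s : ℝ := Real.sqrt q with hs
  have hs0 : 0 < s := Real.sqrt_pos.2 hq0
  have hsq : s ^ 2 = q := Real.sq_sqrt hq0.le
  have hs1 : 1 < s := by
    rw [hs, show (1:ℝ) = Real.sqrt 1 from Real.sqrt_one.symm]
    exact Real.sqrt_lt_sqrt zero_le_one hq1
  set δ : ℝ := 1 / s with hδ
  have hδ0 : 0 < δ := by positivity
  have hδ1 : δ < 1 := by rw [hδ, div_lt_one hs0]; exact hs1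
  have hδq : δ * q = s := by rw [hδ, ← hsq]; field_simp
  have hformula := LFunction_one_eq_smoothed_add_dual χ hχ hχ1 heven hΦ hJ hδ0 hδ1
  -- the smoothed sum
  have hA : ‖∑' n : ℕ, χ ((n + 1 : ℕ) : ZMod q) *
      (((1 - (beurlingReal (δ * (n + 1)) - Real.sinc (π * (δ * (n + 1))) ^ 2)) / (n + 1) : ℝ) : ℂ)‖
        ≤ -Real.log δ - 1 + δ := by
    refine tsum_of_norm_bounded (hasSum_one_sub_vaalerH_div hδ0 hδ1.le) fun n => ?_
    rw [norm_mul, Complex.norm_real, Real.norm_eq_abs,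
      abs_of_nonneg (div_nonneg (one_sub_beurlingReal_sub_sinc_sq_nonneg (by positivity)) (by positivity))]
    exact mul_le_of_le_one_left (div_nonneg (one_sub_beurlingReal_sub_sinc_sq_nonneg (by positivity))
      (by positivity)) (χ.norm_le_one _)
  -- the dual sum
  have hτ : ‖gaussSum χ (ZMod.stdAddChar (N := q))‖ = s := by
    rw [← Real.sqrt_sq (norm_nonneg _), Literature.NumberTheory.Sieve.LargeSieve.norm_gaussSum_sq hχ]
  have hJsum := sum_vaalerJ_le hΦ hJ hs1.le q
  have hJnn : ∀ m : ℕ, 0 ≤ J (((m:ℝ) + 1) / s) := fun m => vaalerJ_nonneg hΦ hJ (by positivity)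
  have hT : ‖gaussSum χ (ZMod.stdAddChar (N := q)) / q *
      ∑ m ∈ Finset.range q, χ⁻¹ ((m + 1 : ℕ) : ZMod q) * (J ((m + 1) / (δ * q)) : ℂ)‖
        ≤ 1 / s * (s - Real.log s + (5 - Real.log π)) := by
    rw [norm_mul, norm_div, hτ, Complex.norm_natCast, hδq]
    have h1 : ‖∑ m ∈ Finset.range q, χ⁻¹ ((m + 1 : ℕ) : ZMod q) * (J ((m + 1) / s) : ℂ)‖
        ≤ ∑ m ∈ Finset.range q, J ((m + 1) / s) := by
      refine (norm_sum_le _ _).trans (Finset.sum_le_sum fun m _ => ?_)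
      rw [norm_mul, Complex.norm_real, Real.norm_eq_abs, abs_of_nonneg (hJnn m)]
      exact mul_le_of_le_one_left (hJnn m) (DirichletCharacter.norm_le_one _ _)
    have h2 : s / q = 1 / s := by rw [← hsq]; field_simp
    rw [h2]
    exact mul_le_mul_of_nonneg_left (h1.trans hJsum) (by positivity)
  have hlogδ : Real.log δ = -Real.log s := by rw [hδ, one_div, Real.log_inv]
  have hlogq : Real.log q = 2 * Real.log s := by
    rw [← hsq, Real.log_pow]; norm_num
  calc ‖χ.LFunction 1‖
      ≤ (-Real.log δ - 1 + δ) + 1 / s * (s - Real.log s + (5 - Real.log π)) := by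
        rw [hformula]; exact (norm_add_le _ _).trans (add_le_add hA hT)
    _ = Real.log s - (Real.log s - (5 - Real.log π) - 1) / s := by
        rw [hlogδ, hδ]; field_simp; ring
    _ = Real.log q / 2 - (Real.log q / 2 - 6 + Real.log π) / s := by
        rw [hlogq]; ring

/-- **A uniform improvement on `½ log q` for even primitive characters of conductor `q ≥ 16`:**
`‖L(1,χ)‖ ≤ ½ log q − 8/(3q)`.  For `q > 25000` (`log q ≥ 10`) this is (6.4) above
(`(½ log q − 6 + log π)√q ≥ 8/3`); for `16 ≤ q ≤ 25000` it is Louboutin's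
`‖L(1,χ)‖ ≤ ½ log q + µ − (½ log q − µ)/√q`, `µ < 0.0231`, since `3µ q + 8 ≤ 3√q(½ log q − µ)` there
(five dyadic ranges, decimal bounds on `log 2`).
[cite: Ramare2001LOneApproximateFormulae, (6.4) p. 262] [cite: Louboutin2001CJM, Thm 7 (15) p. 1197] -/
theorem norm_LFunction_one_le_half_log_sub_div (hχ : χ.IsPrimitive) (hχ1 : χ ≠ 1) (heven : χ.Even)
    (h16 : 16 ≤ q) : ‖χ.LFunction 1‖ ≤ Real.log q / 2 - 8 / (3 * q) := by
  have hqne : q ≠ 0 := NeZero.ne q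
  have hq0 : (0:ℝ) < q := by positivity
  have h16' : (16:ℝ) ≤ q := by exact_mod_cast h16
  set r : ℝ := Real.sqrt q with hr
  have hr0 : 0 < r := Real.sqrt_pos.2 hq0
  have hrsq : r ^ 2 = q := Real.sq_sqrt hq0.le
  have hrge : ∀ {a : ℝ}, 0 ≤ a → a ^ 2 ≤ (q:ℝ) → a ≤ r := fun {a} ha h => by
    rw [hr, ← Real.sqrt_sq ha]; exact Real.sqrt_le_sqrt h
  have hrle : ∀ {b : ℝ}, 0 ≤ b → (q:ℝ) ≤ b ^ 2 → r ≤ b := fun {b} hb h => by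
    rw [hr, ← Real.sqrt_sq hb]; exact Real.sqrt_le_sqrt h
  have hl2 := Real.log_two_gt_d9
  have hlogge : ∀ k : ℕ, (2:ℝ) ^ k ≤ q → (k : ℝ) * 0.6931471803 ≤ Real.log q := fun k hk => by
    have h1 : Real.log ((2:ℝ) ^ k) ≤ Real.log q := Real.log_le_log (by positivity) hk
    rw [Real.log_pow] at h1
    have : (k:ℝ) * 0.6931471803 ≤ k * Real.log 2 :=
      mul_le_mul_of_nonneg_left hl2.le (Nat.cast_nonneg k)
    linarith
  by_cases hq : (q:ℝ) ≤ 25000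
  · -- Louboutin's range
    have h := Louboutin2001.norm_LFunction_one_le_sub χ hχ hχ1 heven
    have hmu := Louboutin2001.mu_lt
    have hmu0 := Louboutin2001.lt_mu
    have hrr : (q:ℝ) ^ (1 / 2 : ℝ) = r := (Real.sqrt_eq_rpow _).symm
    rw [hrr] at h
    set μ := Louboutin2001.mu with hμ
    set L := Real.log q / 2 with hL
    -- the key numerical inequality `3 μ r² + 8 ≤ 3 r (L − μ)` on `4 ≤ r ≤ 158.12`
    have hG : 3 * μ * r ^ 2 + 8 ≤ 3 * r * (L - μ) := by
      have hr4 : 4 ≤ r := hrge (by norm_num) ((by norm_num : (4:ℝ) ^ 2 ≤ 16).trans h16')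
      by_cases h32 : (q:ℝ) ≤ 32
      · have hb : r ≤ 5.66 := hrle (by norm_num) (h32.trans (by norm_num))
        have hL0 : 1.386294 ≤ L := by
          have := hlogge 4 ((by norm_num : (2:ℝ) ^ 4 ≤ 16).trans h16')
          rw [hL]; push_cast at this; linarith
        nlinarith [mul_nonneg (sub_nonneg.2 hr4) (sub_nonneg.2 hb),
          mul_nonneg (mul_nonneg hr0.le hr0.le) (sub_nonneg.2 hmu.le),
          mul_nonneg hr0.le (sub_nonneg.2 hmu.le), mul_nonneg hr0.le (sub_nonneg.2 hL0)]
      have h32' : (32:ℝ) < q := not_le.1 h32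
      by_cases h128 : (q:ℝ) ≤ 128
      · have ha : 5.65 ≤ r := hrge (by norm_num) ((by norm_num : (5.65:ℝ) ^ 2 ≤ 32).trans h32'.le)
        have hb : r ≤ 11.32 := hrle (by norm_num) (h128.trans (by norm_num))
        have hL0 : 1.732867 ≤ L := by
          have := hlogge 5 ((by norm_num : (2:ℝ) ^ 5 ≤ 32).trans h32'.le)
          rw [hL]; push_cast at this; linarith
        nlinarith [mul_nonneg (sub_nonneg.2 ha) (sub_nonneg.2 hb),
          mul_nonneg (mul_nonneg hr0.le hr0.le) (sub_nonneg.2 hmu.le),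
          mul_nonneg hr0.le (sub_nonneg.2 hmu.le), mul_nonneg hr0.le (sub_nonneg.2 hL0)]
      have h128' : (128:ℝ) < q := not_le.1 h128
      by_cases h1024 : (q:ℝ) ≤ 1024
      · have ha : 11.31 ≤ r := hrge (by norm_num) ((by norm_num : (11.31:ℝ) ^ 2 ≤ 128).trans h128'.le)
        have hb : r ≤ 32 := hrle (by norm_num) (h1024.trans (by norm_num))
        have hL0 : 2.426015 ≤ L := by
          have := hlogge 7 ((by norm_num : (2:ℝ) ^ 7 ≤ 128).trans h128'.le)
          rw [hL]; push_cast at this; linarith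
        nlinarith [mul_nonneg (sub_nonneg.2 ha) (sub_nonneg.2 hb),
          mul_nonneg (mul_nonneg hr0.le hr0.le) (sub_nonneg.2 hmu.le),
          mul_nonneg hr0.le (sub_nonneg.2 hmu.le), mul_nonneg hr0.le (sub_nonneg.2 hL0)]
      have h1024' : (1024:ℝ) < q := not_le.1 h1024
      by_cases h16384 : (q:ℝ) ≤ 16384
      · have ha : 32 ≤ r := hrge (by norm_num) ((by norm_num : (32:ℝ) ^ 2 ≤ 1024).trans h1024'.le)
        have hb : r ≤ 128 := hrle (by norm_num) (h16384.trans (by norm_num))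
        have hL0 : 3.465735 ≤ L := by
          have := hlogge 10 ((by norm_num : (2:ℝ) ^ 10 ≤ 1024).trans h1024'.le)
          rw [hL]; push_cast at this; linarith
        nlinarith [mul_nonneg (sub_nonneg.2 ha) (sub_nonneg.2 hb),
          mul_nonneg (mul_nonneg hr0.le hr0.le) (sub_nonneg.2 hmu.le),
          mul_nonneg hr0.le (sub_nonneg.2 hmu.le), mul_nonneg hr0.le (sub_nonneg.2 hL0)]
      · have h16384' : (16384:ℝ) < q := not_le.1 h16384
        have ha : 128 ≤ r := hrge (by norm_num) ((by norm_num : (128:ℝ) ^ 2 ≤ 16384).trans h16384'.le)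
        have hb : r ≤ 158.12 := hrle (by norm_num) (hq.trans (by norm_num))
        have hL0 : 4.852030 ≤ L := by
          have := hlogge 14 ((by norm_num : (2:ℝ) ^ 14 ≤ 16384).trans h16384'.le)
          rw [hL]; push_cast at this; linarith
        nlinarith [mul_nonneg (sub_nonneg.2 ha) (sub_nonneg.2 hb),
          mul_nonneg (mul_nonneg hr0.le hr0.le) (sub_nonneg.2 hmu.le),
          mul_nonneg hr0.le (sub_nonneg.2 hmu.le), mul_nonneg hr0.le (sub_nonneg.2 hL0)]
    have hE : 8 / (3 * (q:ℝ)) ≤ (L - μ) / r - μ := by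
      rw [div_le_iff₀ (by positivity)]
      have : ((L - μ) / r - μ) * (3 * (q:ℝ)) = 3 * r * (L - μ) - 3 * μ * r ^ 2 := by
        rw [← hrsq]; field_simp; try ring
      rw [this]; linarith
    have : ‖χ.LFunction 1‖ ≤ L - ((L - μ) / r - μ) := by rw [hL]; linarith
    linarith
  · -- Ramaré's range, via (6.4)
    rw [not_le] at hq
    have hA := norm_LFunction_one_le_half_log_sub_div_sqrt χ hχ hχ1 heven
    have hlog : (10:ℝ) ≤ Real.log q := by
      rw [Real.le_log_iff_exp_le hq0]
      have := exp_nat_le' (n := 10) (c := 25000) (by norm_num)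
      push_cast at this
      linarith
    have hπ := Literature.Analysis.SpecialFunctions.Real.log_pi_gt_d20
    have hr158 : 158 ≤ r := hrge (by norm_num) ((by norm_num : (158:ℝ) ^ 2 ≤ 25000).trans hq.le)
    have hpos : 0.1447 ≤ Real.log q / 2 - 6 + Real.log π := by linarith
    have hE : 8 / (3 * (q:ℝ)) ≤ (Real.log q / 2 - 6 + Real.log π) / r := by
      rw [div_le_div_iff₀ (by positivity) hr0]
      nlinarith [mul_nonneg hq0.le (sub_nonneg.2 hpos), mul_nonneg hr0.le (sub_nonneg.2 hr158), hrsq]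
    have : ‖χ.LFunction 1‖ ≤ Real.log q / 2 - (Real.log q / 2 - 6 + Real.log π) / r := hA
    linarith

/-- **`‖L(1,χ)‖ ≤ ½ log(q − 4)` for even primitive `χ ≠ 1` of conductor `q ≥ 16`**
(`½ log q − ½ log(q − 4) = ½ log(1 + 4/(q − 4)) ≤ 2/(q − 4) ≤ 8/(3q)` for `q ≥ 16`).
The meeting point of (6.4) and Lemma 19 in the proof of Corollary 2.
[cite: Ramare2001LOneApproximateFormulae, (6.4) p. 262 / §IX p. 265] -/
theorem norm_LFunction_one_le_half_log_sub_four (hχ : χ.IsPrimitive) (hχ1 : χ ≠ 1) (heven : χ.Even)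
    (h16 : 16 ≤ q) : ‖χ.LFunction 1‖ ≤ Real.log ((q : ℝ) - 4) / 2 := by
  have h := norm_LFunction_one_le_half_log_sub_div χ hχ hχ1 heven h16
  have h16' : (16:ℝ) ≤ q := by exact_mod_cast h16
  have hq0 : (0:ℝ) < q := by linarith
  have hq4 : (0:ℝ) < (q:ℝ) - 4 := by linarith
  have h1 : Real.log q - Real.log ((q:ℝ) - 4) ≤ 4 / ((q:ℝ) - 4) := by
    rw [← Real.log_div hq0.ne' hq4.ne']
    have h2 := Real.log_le_sub_one_of_pos (show (0:ℝ) < q / (q - 4) by positivity)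
    have h3 : (q:ℝ) / (q - 4) - 1 = 4 / ((q:ℝ) - 4) := by field_simp; ring
    linarith
  have h2 : 4 / ((q:ℝ) - 4) ≤ 16 / (3 * (q:ℝ)) := by
    rw [div_le_div_iff₀ hq4 (by positivity)]; nlinarith
  have h3 : (16:ℝ) / (3 * (q:ℝ)) = 2 * (8 / (3 * (q:ℝ))) := by ring
  rw [h3] at h2
  linarith

end SecondaryTerm

/-! ## Step 3: Lemma 19 — the fundamental unit and the regulator -/

section Regulator

open Module NumberField Literature.NumberTheory.QuadraticFields
  Literature.NumberTheory.QuadraticFields.Quadratic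

variable {K : Type*} [Field K] [NumberField K]

/-- **Ramaré 2001, Lemma 19** (= Le 1994, Lemma 4 (1)): for a positive non-square discriminant `D`,
the fundamental unit satisfies `ε_D ≥ (√(D − 4) + √D)/2` (`ε_D = (G + B√D)/2` with `G² − DB² = ±4`,
`G, B ≥ 1`, so `G² ≥ D − 4`). [cite: Ramare2001LOneApproximateFormulae, Lemma 19 p. 265]
[cite: Le1994, Lemma 4 (1) p. 142] -/
theorem sqrt_sub_four_add_sqrt_div_two_le_fundUnit {D : ℕ} (hD : ¬ IsSquare D)
    (hD4 : D % 4 = 0 ∨ D % 4 = 1) :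
    (Real.sqrt ((D : ℝ) - 4) + Real.sqrt D) / 2 ≤ QuadIrr.fundUnit D := by
  obtain ⟨G, B, hG, hB, hN, hε, -⟩ := QuadIrr.exists_fundUnit_eq hD hD4
  rw [hε]
  have hG' : (1:ℝ) ≤ G := by exact_mod_cast hG
  have hB' : (1:ℝ) ≤ B := by exact_mod_cast hB
  have hs0 : 0 ≤ Real.sqrt D := Real.sqrt_nonneg _
  have hD0 : (0:ℝ) ≤ D := Nat.cast_nonneg D
  have hB2 : (1:ℝ) ≤ (B:ℝ) ^ 2 := by nlinarith
  have hGsq : (D:ℝ) - 4 ≤ (G:ℝ) ^ 2 := by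
    rcases hN with h | h
    · have h' : ((G:ℝ)) ^ 2 - (D:ℝ) * (B:ℝ) ^ 2 = 4 := by exact_mod_cast h
      nlinarith
    · have h' : ((G:ℝ)) ^ 2 - (D:ℝ) * (B:ℝ) ^ 2 = -4 := by exact_mod_cast h
      nlinarith
  have h1 : Real.sqrt ((D:ℝ) - 4) ≤ G :=
    calc Real.sqrt ((D:ℝ) - 4) ≤ Real.sqrt ((G:ℝ) ^ 2) := Real.sqrt_le_sqrt hGsq
      _ = G := Real.sqrt_sq (by linarith)
  have h2 : Real.sqrt D ≤ B * Real.sqrt D := le_mul_of_one_le_left hs0 hB'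
  linarith

/-- **`R_K ≥ ½ log(d_K − 4)` for a real quadratic field** with `d_K > 4`: `R_K = log ε_{d_K}` (tree
`Quadratic.regulator_eq_log_fundUnit'`) and `ε_d ≥ (√(d−4) + √d)/2 ≥ √(d − 4)` (Lemma 19).
[cite: Ramare2001LOneApproximateFormulae, Lemma 19 p. 265] -/
theorem half_log_discr_sub_four_le_regulator (h2 : finrank ℚ K = 2) (hd4 : 4 < NumberField.discr K) :
    Real.log ((NumberField.discr K : ℝ) - 4) / 2 ≤ NumberField.Units.regulator K := by
  have hd : 0 < NumberField.discr K := by omega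
  rw [regulator_eq_log_fundUnit' h2 hd]
  set D := (NumberField.discr K).toNat with hD
  have hDR : ((D : ℕ) : ℝ) = (NumberField.discr K : ℝ) := by
    have : ((D : ℕ) : ℤ) = NumberField.discr K := Int.toNat_of_nonneg hd.le
    exact_mod_cast this
  have hε := sqrt_sub_four_add_sqrt_div_two_le_fundUnit (not_isSquare_discr_toNat h2 hd)
    (discr_toNat_mod_four h2 hd)
  rw [hDR] at hε
  have h4' : (0:ℝ) < (NumberField.discr K : ℝ) - 4 := by
    have : (4:ℝ) < (NumberField.discr K : ℝ) := by exact_mod_cast hd4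
    linarith
  have hpos : 0 < Real.sqrt ((NumberField.discr K : ℝ) - 4) := Real.sqrt_pos.2 h4'
  have hle : Real.sqrt ((NumberField.discr K : ℝ) - 4) ≤ QuadIrr.fundUnit D := by
    have hs : Real.sqrt ((NumberField.discr K : ℝ) - 4) ≤ Real.sqrt (NumberField.discr K : ℝ) :=
      Real.sqrt_le_sqrt (by linarith)
    linarith
  calc Real.log ((NumberField.discr K : ℝ) - 4) / 2
      = Real.log (Real.sqrt ((NumberField.discr K : ℝ) - 4)) := (Real.log_sqrt h4'.le).symm
    _ ≤ Real.log (QuadIrr.fundUnit D) := Real.log_le_log hpos hle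

end Regulator

/-! ## Step 4: the Kronecker character and the assembly -/

section Assembly

open Module NumberField DirichletCharacter Literature.NumberTheory.QuadraticFields
  Literature.NumberTheory.QuadraticFields.Quadratic

variable {K : Type*} [Field K] [NumberField K]

/-- The Kronecker character of a REAL quadratic field is an even primitive character `κ ≠ 1` mod `d_K`
with `ζ_K(s) = ζ(s) L(s, κ)` (`Re s > 1`) — odd `d_K ≡ 1 (mod 4)`: the Jacobi character, even by
`(−1/d_K) = χ₄(d_K) = 1`; even `d_K`: the tree's Kronecker character mod `4|m|`
(`Quadratic.exists_kroneckerChar_of_four_dvd`, parity included). [folklore] -/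
private theorem exists_even_primitive_kroneckerChar (h2 : finrank ℚ K = 2)
    (hd : 0 < NumberField.discr K) :
    ∃ (M : ℕ) (_ : NeZero M) (κ : DirichletCharacter ℂ M), M = (NumberField.discr K).natAbs ∧ κ ≠ 1 ∧
      κ.IsPrimitive ∧ κ.Even ∧
      ∀ s : ℂ, 1 < s.re → NumberField.dedekindZeta K s = riemannZeta s * LSeries (fun n ↦ κ n) s := by
  rcases isFundamentalDiscriminant_discr (K := K) h2 with ⟨h1, hsqf, -⟩ | ⟨h4, -, -⟩
  · -- odd discriminant `d ≡ 1 (mod 4)`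
    have hodd : Odd (NumberField.discr K) := by rw [Int.odd_iff]; omega
    haveI := neZero_natAbs_discr (K := K)
    have hoddN : Odd (NumberField.discr K).natAbs := Int.natAbs_odd.mpr hodd
    have hsqN : Squarefree (NumberField.discr K).natAbs := Int.squarefree_natAbs.mpr hsqf
    have hmod : (NumberField.discr K).natAbs % 4 = 1 := by
      have : ((NumberField.discr K).natAbs : ℤ) = NumberField.discr K :=
        Int.natAbs_of_nonneg hd.le
      omega
    have heven : (jacobiChar (NumberField.discr K).natAbs).Even := by
      show jacobiChar (NumberField.discr K).natAbs (-1) = 1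
      have h := jacobiChar_intCast (q := (NumberField.discr K).natAbs) (-1)
      rw [Int.cast_neg, Int.cast_one] at h
      rw [h, jacobiSym.at_neg_one hoddN, ZMod.χ₄_nat_one_mod_four hmod, Int.cast_one]
    exact ⟨(NumberField.discr K).natAbs, inferInstance, jacobiChar (NumberField.discr K).natAbs, rfl,
      jacobiChar_natAbs_discr_ne_one h2 hodd, isPrimitive_jacobiChar hoddN hsqN, heven,
      fun s hs ↦ dedekindZeta_eq_riemannZeta_mul_LSeries h2 hodd hs⟩
  · -- even discriminant
    haveI := neZero_natAbs_discr (K := K)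
    obtain ⟨κ, hprim, -, hne, -, hev, -, hfac⟩ := exists_kroneckerChar_of_four_dvd h2 h4
    exact ⟨(NumberField.discr K).natAbs, inferInstance, κ, rfl, hne, hprim, hev hd, hfac⟩

/-- **`Res_{s=1} ζ_K ≤ ½ log(d_K − 4)` for a real quadratic field with `d_K ≥ 16`** — step 2 read on
the field through its even primitive Kronecker character (`Res_{s=1} ζ_K = L(1, κ_K)`).
[cite: Ramare2001LOneApproximateFormulae, §IX p. 265] -/
theorem dedekindZeta_residue_le_half_log_sub_four (h2 : finrank ℚ K = 2)
    (h16 : (16 : ℤ) ≤ NumberField.discr K) :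
    NumberField.dedekindZeta_residue K ≤ Real.log ((NumberField.discr K : ℝ) - 4) / 2 := by
  have hd : 0 < NumberField.discr K := by omega
  obtain ⟨M, _, κ, hM, hκ, hprim, heven, hfac⟩ := exists_even_primitive_kroneckerChar h2 hd
  have hL : κ.LFunction 1 = (NumberField.dedekindZeta_residue K : ℂ) :=
    LFunction_one_eq_dedekindZeta_residue_of_eq (K := K) hκ (fun s hs ↦ hfac s (by simpa using hs))
  have hM16 : 16 ≤ M := by
    have : ((NumberField.discr K).natAbs : ℤ) = NumberField.discr K := Int.natAbs_of_nonneg hd.le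
    omega
  have hB := norm_LFunction_one_le_half_log_sub_four κ hprim hκ heven hM16
  rw [hL, Complex.norm_real, Real.norm_eq_abs] at hB
  have hMd : (M : ℝ) = (NumberField.discr K : ℝ) := by
    obtain ⟨n, hn⟩ := Int.eq_ofNat_of_zero_le hd.le
    rw [hM, hn]; simp
  rw [hMd] at hB
  exact (le_abs_self _).trans hB

/-- **Le 1994 / Ramaré 2001, Corollary 2 — `h_K ≤ √d_K/2` for every real quadratic field `K` with
`d_K ≥ 16`.**  Class number formula `Res_{s=1} ζ_K = 2 h_K R_K/√d_K` (Mathlib, `r₁ = 2`, `r₂ = 0`,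
`w_K = 2`), `Res_{s=1} ζ_K ≤ ½ log(d_K − 4) ≤ R_K` (steps 2–3).
[cite: Ramare2001LOneApproximateFormulae, Cor. 2 p. 248 / §IX p. 265] [cite: Le1994, Theorem (a) p. 141] -/
theorem classNumber_le_half_sqrt (h2 : finrank ℚ K = 2) (h16 : (16 : ℤ) ≤ NumberField.discr K) :
    (NumberField.classNumber K : ℝ) ≤ Real.sqrt (NumberField.discr K : ℝ) / 2 := by
  have hd : 0 < NumberField.discr K := by omega
  have hres := dedekindZeta_residue_le_half_log_sub_four h2 h16
  have hR := half_log_discr_sub_four_le_regulator h2 (by omega : 4 < NumberField.discr K)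
  have hRpos := NumberField.Units.regulator_pos K
  obtain ⟨hr₁, hr₂⟩ := nrRealPlaces_eq_two_and_nrComplexPlaces_eq_zero h2 hd
  have hw := torsionOrder_eq_two_of_discr_pos h2 hd
  have hsq : 0 < Real.sqrt (NumberField.discr K : ℝ) := Real.sqrt_pos.2 (by exact_mod_cast hd)
  have hform : NumberField.dedekindZeta_residue K =
      2 * NumberField.Units.regulator K * NumberField.classNumber K /
        Real.sqrt (NumberField.discr K : ℝ) := by
    rw [NumberField.dedekindZeta_residue_def, hr₁, hr₂, hw]
    have habs : |(NumberField.discr K : ℝ)| = NumberField.discr K := abs_of_pos (by exact_mod_cast hd)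
    rw [habs, show ((2 : ℕ) : ℝ) = 2 by norm_num]
    ring
  have h3 : 2 * NumberField.Units.regulator K * NumberField.classNumber K /
      Real.sqrt (NumberField.discr K : ℝ) ≤ NumberField.Units.regulator K := by
    rw [← hform]; exact hres.trans hR
  rw [div_le_iff₀ hsq] at h3
  have h4 : 2 * (NumberField.classNumber K : ℝ) ≤ Real.sqrt (NumberField.discr K : ℝ) := by
    have h5 : NumberField.Units.regulator K * (2 * (NumberField.classNumber K : ℝ)) ≤
        NumberField.Units.regulator K * Real.sqrt (NumberField.discr K : ℝ) := by nlinarith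
    exact le_of_mul_le_mul_left h5 hRpos
  linarith

/-- Corollary 2 in the quantified shape of the named fact `ramare2001_corollary2`
(`ExplicitLOneUpperBounds.lean`). [cite: Ramare2001LOneApproximateFormulae, Cor. 2 p. 248] -/
theorem ramare2001_corollary2' :
    ∀ (K : Type) [Field K] [NumberField K], Module.finrank ℚ K = 2 → (16 : ℤ) ≤ NumberField.discr K →
      (NumberField.classNumber K : ℝ) ≤ Real.sqrt (NumberField.discr K : ℝ) / 2 :=
  fun _ _ _ h2 h16 => classNumber_le_half_sqrt h2 h16

end Assembly

end Literature.NumberTheory.LFunctions.Ramare2001
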